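import Summits.KontsevichZagierPeriods.Zeta5Search.WellPoisedFaceBoundaryRate
import HarnessLib

/-!
# ζ(5) search — log-convexity and decay of Zudilin's face function `R(t)` (cell `pub-zeta5`, fam-vwp gen 6, file 3)

HONEST FRAMING: systematic search; no irrationality claim unless certified.

Continues `WellPoisedFaceBoundaryRate.lean` (same namespace), where `faceR` = Zudilin's `R(t)` on the numerator-free
face `h₁ = h₂ = h₃ = 1` of the `r = 3`, `q = 7` box [cite: Zudilin2004, §8 (8.2), (8.6), (8.7)] and `faceF = ½ Σ_{t∈ℕ} R″(t)`
were TYPED and the Stirling rate of `R_n(0)` was proved.  This file proves parts (i) and the pointwise half of (ii) of OUR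
boundary lemma (families/vwp/FAMILY.md §14.2), previously on paper:
* §6 closed form by logarithmic differentiation: for `t > -1/2`, `R = exp ∘ logFaceR`,
  `R′ = R·dlogR`, `R″ = iteratedDeriv 2 R = R·(dlogR² + d2logR)` (`iteratedDeriv_two_faceR`), where
  `dlogR = 2/(h₀+2t) − Σ_j Σ_{i<L_j} 1/(t+h_j+i)` and `d2logR = −4/(h₀+2t)² + Σ_j Σ_i 1/(t+h_j+i)²`;
* §7 signs and sizes on `t ≥ 0`: `d2logR > 0` (LOG-CONVEXITY — the four `i = 0` pole terms beat `4/(h₀+2t)²` since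
  `h_j < h₀`), `|dlogR| ≤ 1 + 4h₀`, `d2logR ≤ 4h₀`, hence `0 < R″ ≤ 25 h₀² R`;
* §8 decay: `R(t) ≤ 2h₀³/(t+h₀)³ · R(0)` for `t ≥ 0` (each colour block loses a factor `h₀/(t+h₀)`).
The companion file 4 (`WellPoisedFaceSandwich.lean`) sums these into `2R(0)/h₀² ≤ F ≤ (25π²/6) h₀⁵ R(0)` and the
unconditional rate `(1/n) log F_n → −C₀`.  Standard axioms only; no new definitions beyond the three derivative
expressions `dlogR`, `d2logR`, `logFaceR`.
-/

noncomputable section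

open Real Filter Topology Finset

namespace Summit.KontsevichZagierPeriods.Zeta5Search.WellPoisedFaceRate

/-! ## 6. Closed form of `R″` by logarithmic differentiation
For `t > -1/2` every factor of `R` is positive, `R = exp ∘ logFaceR`, and
`R″ = R · ((log R)′² + (log R)″)` with the two logarithmic derivatives below. -/

/-- `(log R)′(t) = 2/(h₀+2t) − Σ_j Σ_{i<L_j} 1/(t+h_j+i)`. -/
def dlogR (η₀ : ℕ) (η : Fin 4 → ℕ) (n : ℕ) (t : ℝ) : ℝ :=
  2 / (((η₀ * n + 2 : ℕ) : ℝ) + 2 * t) -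
    ∑ j : Fin 4, ∑ i ∈ Finset.range ((η₀ * n + 2) - 2 * (η j * n + 1) + 1),
      1 / (t + ((η j * n + 1 : ℕ) : ℝ) + (i : ℝ))

/-- `(log R)″(t) = −4/(h₀+2t)² + Σ_j Σ_{i<L_j} 1/(t+h_j+i)²`. -/
def d2logR (η₀ : ℕ) (η : Fin 4 → ℕ) (n : ℕ) (t : ℝ) : ℝ :=
  -4 / (((η₀ * n + 2 : ℕ) : ℝ) + 2 * t) ^ 2 +
    ∑ j : Fin 4, ∑ i ∈ Finset.range ((η₀ * n + 2) - 2 * (η j * n + 1) + 1),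
      1 / (t + ((η j * n + 1 : ℕ) : ℝ) + (i : ℝ)) ^ 2

/-- `log R(t)` written out (valid for `t > -1/2`). -/
def logFaceR (η₀ : ℕ) (η : Fin 4 → ℕ) (n : ℕ) (t : ℝ) : ℝ :=
  Real.log (((η₀ * n + 2 : ℕ) : ℝ) + 2 * t) +
    ∑ j : Fin 4, (Real.log ((((η₀ * n + 2) - 2 * (η j * n + 1)).factorial : ℕ) : ℝ) -
      ∑ i ∈ Finset.range ((η₀ * n + 2) - 2 * (η j * n + 1) + 1),
        Real.log (t + ((η j * n + 1 : ℕ) : ℝ) + (i : ℝ)))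

/-- `h₀ + 2t > 0` for `t > -1/2`. -/
theorem lin_pos (η₀ n : ℕ) {t : ℝ} (ht : -1/2 < t) : 0 < ((η₀ * n + 2 : ℕ) : ℝ) + 2 * t := by
  have : (0 : ℝ) ≤ ((η₀ * n : ℕ) : ℝ) := Nat.cast_nonneg _
  push_cast at this ⊢; linarith

/-- every pole factor `t + h_j + i` is positive for `t > -1/2`. -/
theorem pole_pos (η : Fin 4 → ℕ) (n : ℕ) {t : ℝ} (ht : -1/2 < t) (j : Fin 4) (i : ℕ) :
    0 < t + ((η j * n + 1 : ℕ) : ℝ) + (i : ℝ) := by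
  have h1 : (0 : ℝ) ≤ ((η j * n : ℕ) : ℝ) := Nat.cast_nonneg _
  have h2 : (0 : ℝ) ≤ (i : ℝ) := Nat.cast_nonneg _
  push_cast at h1 ⊢; linarith

/-- `R = exp ∘ logFaceR` on `t > -1/2`. -/
theorem faceR_eq_exp (η₀ : ℕ) (η : Fin 4 → ℕ) (n : ℕ) {t : ℝ} (ht : -1/2 < t) :
    faceR η₀ η n t = Real.exp (logFaceR η₀ η n t) := by
  have hlin := lin_pos η₀ n ht
  have hpole := pole_pos η n ht
  unfold faceR logFaceR
  rw [Real.exp_add, Real.exp_log hlin, Real.exp_sum]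
  congr 1
  refine Finset.prod_congr rfl fun j _ => ?_
  rw [Real.exp_sub, Real.exp_log (by positivity), Real.exp_sum]
  congr 1
  exact Finset.prod_congr rfl fun i _ => (Real.exp_log (hpole j i)).symm

/-- `(logFaceR)′ = dlogR` on `t > -1/2`. -/
theorem hasDerivAt_logFaceR (η₀ : ℕ) (η : Fin 4 → ℕ) (n : ℕ) {t : ℝ} (ht : -1/2 < t) :
    HasDerivAt (logFaceR η₀ η n) (dlogR η₀ η n t) t := by
  have hlin := lin_pos η₀ n ht
  have hpole := pole_pos η n ht
  have h1 : HasDerivAt (fun s : ℝ => Real.log (((η₀ * n + 2 : ℕ) : ℝ) + 2 * s))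
      (2 / (((η₀ * n + 2 : ℕ) : ℝ) + 2 * t)) t :=
    ((((hasDerivAt_id' (x := t)).const_mul (2 : ℝ)).const_add (((η₀ * n + 2 : ℕ) : ℝ))).log
      hlin.ne').congr_deriv (by simp)
  have h2 : ∀ j : Fin 4, HasDerivAt
      (fun s : ℝ => Real.log ((((η₀ * n + 2) - 2 * (η j * n + 1)).factorial : ℕ) : ℝ) -
        ∑ i ∈ Finset.range ((η₀ * n + 2) - 2 * (η j * n + 1) + 1),
          Real.log (s + ((η j * n + 1 : ℕ) : ℝ) + (i : ℝ)))
      (0 - ∑ i ∈ Finset.range ((η₀ * n + 2) - 2 * (η j * n + 1) + 1),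
          1 / (t + ((η j * n + 1 : ℕ) : ℝ) + (i : ℝ))) t := fun j =>
    (hasDerivAt_const t _).fun_sub (HasDerivAt.fun_sum fun i _ =>
      (((hasDerivAt_id' (x := t)).add_const (((η j * n + 1 : ℕ) : ℝ))).add_const (i : ℝ)).log
        (hpole j i).ne')
  exact (h1.fun_add (HasDerivAt.fun_sum fun j _ => h2 j)).congr_deriv
    (by simp only [dlogR, zero_sub, Finset.sum_neg_distrib]; ring)

/-- `(dlogR)′ = d2logR` on `t > -1/2`. -/
theorem hasDerivAt_dlogR (η₀ : ℕ) (η : Fin 4 → ℕ) (n : ℕ) {t : ℝ} (ht : -1/2 < t) :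
    HasDerivAt (dlogR η₀ η n) (d2logR η₀ η n t) t := by
  have hlin := lin_pos η₀ n ht
  have hpole := pole_pos η n ht
  have h1 : HasDerivAt (fun s : ℝ => 2 / (((η₀ * n + 2 : ℕ) : ℝ) + 2 * s))
      (-4 / (((η₀ * n + 2 : ℕ) : ℝ) + 2 * t) ^ 2) t :=
    ((hasDerivAt_const t (2 : ℝ)).fun_div
      (((hasDerivAt_id' (x := t)).const_mul (2 : ℝ)).const_add (((η₀ * n + 2 : ℕ) : ℝ)))
      hlin.ne').congr_deriv (by simp only [zero_mul, mul_one, zero_sub]; ring)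
  have h2 : ∀ j : Fin 4, HasDerivAt
      (fun s : ℝ => ∑ i ∈ Finset.range ((η₀ * n + 2) - 2 * (η j * n + 1) + 1),
          1 / (s + ((η j * n + 1 : ℕ) : ℝ) + (i : ℝ)))
      (∑ i ∈ Finset.range ((η₀ * n + 2) - 2 * (η j * n + 1) + 1),
          (0 * (t + ((η j * n + 1 : ℕ) : ℝ) + (i : ℝ)) - 1 * 1)
            / (t + ((η j * n + 1 : ℕ) : ℝ) + (i : ℝ)) ^ 2) t := fun j =>
    HasDerivAt.fun_sum fun i _ =>
      (hasDerivAt_const t (1 : ℝ)).fun_div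
        (((hasDerivAt_id' (x := t)).add_const (((η j * n + 1 : ℕ) : ℝ))).add_const (i : ℝ))
        (hpole j i).ne'
  exact (h1.fun_sub (HasDerivAt.fun_sum fun j _ => h2 j)).congr_deriv
    (by simp only [d2logR, zero_mul, mul_one, zero_sub, neg_div, Finset.sum_neg_distrib,
          sub_neg_eq_add])

/-- `R′ = R · (log R)′` on `t > -1/2`. -/
theorem hasDerivAt_faceR (η₀ : ℕ) (η : Fin 4 → ℕ) (n : ℕ) {t : ℝ} (ht : -1/2 < t) :
    HasDerivAt (faceR η₀ η n) (faceR η₀ η n t * dlogR η₀ η n t) t := by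
  have hev : (fun s => Real.exp (logFaceR η₀ η n s)) =ᶠ[𝓝 t] faceR η₀ η n :=
    (eventually_gt_nhds ht).mono fun s hs => (faceR_eq_exp η₀ η n hs).symm
  have h := (hasDerivAt_logFaceR η₀ η n ht).exp
  rw [faceR_eq_exp η₀ η n ht]
  exact h.congr_of_eventuallyEq hev.symm

/-- `deriv R = R · dlogR` on `t > -1/2`. -/
theorem deriv_faceR (η₀ : ℕ) (η : Fin 4 → ℕ) (n : ℕ) {t : ℝ} (ht : -1/2 < t) :
    deriv (faceR η₀ η n) t = faceR η₀ η n t * dlogR η₀ η n t :=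
  (hasDerivAt_faceR η₀ η n ht).deriv

/-- `(R′)′ = R · ((log R)′² + (log R)″)` on `t > -1/2`. -/
theorem hasDerivAt_deriv_faceR (η₀ : ℕ) (η : Fin 4 → ℕ) (n : ℕ) {t : ℝ} (ht : -1/2 < t) :
    HasDerivAt (deriv (faceR η₀ η n))
      (faceR η₀ η n t * (dlogR η₀ η n t ^ 2 + d2logR η₀ η n t)) t := by
  have hev : (fun s => faceR η₀ η n s * dlogR η₀ η n s) =ᶠ[𝓝 t] deriv (faceR η₀ η n) :=
    (eventually_gt_nhds ht).mono fun s hs => (deriv_faceR η₀ η n hs).symm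
  exact (((hasDerivAt_faceR η₀ η n ht).fun_mul (hasDerivAt_dlogR η₀ η n ht)).congr_of_eventuallyEq
    hev.symm).congr_deriv (by ring)

/-- CLOSED FORM: for `t > -1/2`, `R″(t) = R(t)·((log R)′(t)² + (log R)″(t))`. -/
theorem iteratedDeriv_two_faceR (η₀ : ℕ) (η : Fin 4 → ℕ) (n : ℕ) {t : ℝ} (ht : -1/2 < t) :
    iteratedDeriv 2 (faceR η₀ η n) t
      = faceR η₀ η n t * (dlogR η₀ η n t ^ 2 + d2logR η₀ η n t) := by
  rw [show (2 : ℕ) = 1 + 1 from rfl, iteratedDeriv_succ, iteratedDeriv_one]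
  exact (hasDerivAt_deriv_faceR η₀ η n ht).deriv
/-! ## 7. Signs and sizes for `t ≥ 0`
`R > 0`; `(log R)″ > 0` (the four `i = 0` pole terms `1/(t+h_j)²` already beat `4/(h₀+2t)²` because
`h_j < h₀`); `|(log R)′| ≤ 1 + 4h₀`, `(log R)″ ≤ 4h₀`; hence `0 ≤ R″ ≤ 25 h₀² R` on `t ≥ 0`. -/

/-- `R(t) > 0` for `t > -1/2`. -/
theorem faceR_pos (η₀ : ℕ) (η : Fin 4 → ℕ) (n : ℕ) {t : ℝ} (ht : -1/2 < t) :
    0 < faceR η₀ η n t := by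
  rw [faceR_eq_exp η₀ η n ht]; exact Real.exp_pos _

/-- `h_j < h₀` on an integral face direction. -/
theorem hj_lt_h0 (η₀ : ℕ) (η : Fin 4 → ℕ) (hη : ∀ j, 2 * η j < η₀) (n : ℕ) (j : Fin 4) :
    ((η j * n + 1 : ℕ) : ℝ) < ((η₀ * n + 2 : ℕ) : ℝ) := by
  have h1 : η j ≤ η₀ := by have := hη j; omega
  have h2 : η j * n ≤ η₀ * n := Nat.mul_le_mul_right n h1
  exact_mod_cast (by omega : η j * n + 1 < η₀ * n + 2)

/-- the colour-`j` block has `L_j ≤ h₀` poles. -/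
theorem range_card_le (η₀ : ℕ) (η : Fin 4 → ℕ) (n : ℕ) (j : Fin 4) :
    (∑ _i ∈ Finset.range ((η₀ * n + 2) - 2 * (η j * n + 1) + 1), (1 : ℝ))
      ≤ ((η₀ * n + 2 : ℕ) : ℝ) := by
  simp only [Finset.sum_const, Finset.card_range, nsmul_eq_mul, mul_one]
  exact_mod_cast (by omega : (η₀ * n + 2) - 2 * (η j * n + 1) + 1 ≤ η₀ * n + 2)

/-- LOG-CONVEXITY: `(log R)″(t) > 0` for `t ≥ 0`. -/
theorem d2logR_pos (η₀ : ℕ) (η : Fin 4 → ℕ) (hη : ∀ j, 2 * η j < η₀) (n : ℕ) {t : ℝ} (ht : 0 ≤ t) :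
    0 < d2logR η₀ η n t := by
  have ht' : -1/2 < t := by linarith
  have hlin := lin_pos η₀ n ht'
  have hpole := pole_pos η n ht'
  have hh := hj_lt_h0 η₀ η hη n
  have key : ∀ j : Fin 4, 1 / ((((η₀ * n + 2 : ℕ) : ℝ) + 2 * t)) ^ 2 <
      ∑ i ∈ Finset.range ((η₀ * n + 2) - 2 * (η j * n + 1) + 1),
        1 / (t + ((η j * n + 1 : ℕ) : ℝ) + (i : ℝ)) ^ 2 := by
    intro j
    have h0mem : 0 ∈ Finset.range (((η₀ * n + 2) - 2 * (η j * n + 1)) + 1) := by simp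
    have hle := Finset.single_le_sum
      (f := fun i : ℕ => 1 / (t + ((η j * n + 1 : ℕ) : ℝ) + (i : ℝ)) ^ 2)
      (fun i _ => by have := hpole j i; positivity) h0mem
    simp only [Nat.cast_zero, add_zero] at hle
    have hposj : 0 < t + ((η j * n + 1 : ℕ) : ℝ) := by simpa using hpole j 0
    have hlt : 1 / ((((η₀ * n + 2 : ℕ) : ℝ) + 2 * t)) ^ 2 <
        1 / (t + ((η j * n + 1 : ℕ) : ℝ)) ^ 2 := by
      apply one_div_lt_one_div_of_lt (by positivity)
      apply pow_lt_pow_left₀ _ hposj.le two_ne_zero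
      linarith [hh j]
    exact hlt.trans_le hle
  have hsum := Finset.sum_lt_sum_of_nonempty (Finset.univ_nonempty (α := Fin 4))
    fun j (_ : j ∈ (Finset.univ : Finset (Fin 4))) => key j
  simp only [Finset.sum_const, Finset.card_univ, Fintype.card_fin, nsmul_eq_mul] at hsum
  unfold d2logR
  have : -4 / ((((η₀ * n + 2 : ℕ) : ℝ) + 2 * t)) ^ 2
      + (4 : ℕ) * (1 / ((((η₀ * n + 2 : ℕ) : ℝ) + 2 * t)) ^ 2) = 0 := by push_cast; ring
  linarith

/-- `Σ_j Σ_i 1/(t+h_j+i) ≤ 4h₀` for `t ≥ 0`. -/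
theorem polesum_le (η₀ : ℕ) (η : Fin 4 → ℕ) (n : ℕ) {t : ℝ} (ht : 0 ≤ t) :
    (∑ j : Fin 4, ∑ i ∈ Finset.range ((η₀ * n + 2) - 2 * (η j * n + 1) + 1),
      1 / (t + ((η j * n + 1 : ℕ) : ℝ) + (i : ℝ))) ≤ 4 * ((η₀ * n + 2 : ℕ) : ℝ) := by
  have hpole := pole_pos η n (by linarith : -1/2 < t)
  have hj : ∀ j : Fin 4, (∑ i ∈ Finset.range ((η₀ * n + 2) - 2 * (η j * n + 1) + 1),
      1 / (t + ((η j * n + 1 : ℕ) : ℝ) + (i : ℝ))) ≤ ((η₀ * n + 2 : ℕ) : ℝ) := by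
    intro j
    refine le_trans (Finset.sum_le_sum fun i _ => ?_) (range_card_le η₀ η n j)
    rw [div_le_one (hpole j i)]
    have h1 : (1 : ℝ) ≤ ((η j * n + 1 : ℕ) : ℝ) := by exact_mod_cast Nat.le_add_left 1 _
    have h2 : (0 : ℝ) ≤ (i : ℝ) := Nat.cast_nonneg _
    linarith
  calc _ ≤ ∑ _j : Fin 4, ((η₀ * n + 2 : ℕ) : ℝ) := Finset.sum_le_sum fun j _ => hj j
    _ = 4 * ((η₀ * n + 2 : ℕ) : ℝ) := by
      simp only [Finset.sum_const, Finset.card_univ, Fintype.card_fin, nsmul_eq_mul]; push_cast; ring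

/-- `Σ_j Σ_i 1/(t+h_j+i)² ≤ 4h₀` for `t ≥ 0`. -/
theorem polesum_sq_le (η₀ : ℕ) (η : Fin 4 → ℕ) (n : ℕ) {t : ℝ} (ht : 0 ≤ t) :
    (∑ j : Fin 4, ∑ i ∈ Finset.range ((η₀ * n + 2) - 2 * (η j * n + 1) + 1),
      1 / (t + ((η j * n + 1 : ℕ) : ℝ) + (i : ℝ)) ^ 2) ≤ 4 * ((η₀ * n + 2 : ℕ) : ℝ) := by
  have hpole := pole_pos η n (by linarith : -1/2 < t)
  refine le_trans (Finset.sum_le_sum fun j _ => Finset.sum_le_sum fun i _ => ?_) (polesum_le η₀ η n ht)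
  -- 1/x^2 ≤ 1/x for x ≥ 1
  have h1 : (1 : ℝ) ≤ ((η j * n + 1 : ℕ) : ℝ) := by exact_mod_cast Nat.le_add_left 1 _
  have h2 : (0 : ℝ) ≤ (i : ℝ) := Nat.cast_nonneg _
  have hx : 1 ≤ t + ((η j * n + 1 : ℕ) : ℝ) + (i : ℝ) := by linarith
  apply one_div_le_one_div_of_le (hpole j i)
  nlinarith

/-- `|(log R)′(t)| ≤ 1 + 4h₀` for `t ≥ 0`. -/
theorem abs_dlogR_le (η₀ : ℕ) (η : Fin 4 → ℕ) (n : ℕ) {t : ℝ} (ht : 0 ≤ t) :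
    |dlogR η₀ η n t| ≤ 1 + 4 * ((η₀ * n + 2 : ℕ) : ℝ) := by
  have ht' : -1/2 < t := by linarith
  have hlin := lin_pos η₀ n ht'
  have hpole := pole_pos η n ht'
  have h2le : 2 / ((((η₀ * n + 2 : ℕ) : ℝ) + 2 * t)) ≤ 1 := by
    rw [div_le_one hlin]
    have : (2 : ℝ) ≤ ((η₀ * n + 2 : ℕ) : ℝ) := by exact_mod_cast Nat.le_add_left 2 _
    linarith
  have h2nn : 0 ≤ 2 / ((((η₀ * n + 2 : ℕ) : ℝ) + 2 * t)) := by positivity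
  have hS := polesum_le η₀ η n ht
  have hSnn : 0 ≤ ∑ j : Fin 4, ∑ i ∈ Finset.range ((η₀ * n + 2) - 2 * (η j * n + 1) + 1),
      1 / (t + ((η j * n + 1 : ℕ) : ℝ) + (i : ℝ)) :=
    Finset.sum_nonneg fun j _ => Finset.sum_nonneg fun i _ => (one_div_pos.mpr (hpole j i)).le
  unfold dlogR
  rw [abs_le]; constructor <;> linarith

/-- `(log R)″(t) ≤ 4h₀` for `t ≥ 0`. -/
theorem d2logR_le (η₀ : ℕ) (η : Fin 4 → ℕ) (n : ℕ) {t : ℝ} (ht : 0 ≤ t) :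
    d2logR η₀ η n t ≤ 4 * ((η₀ * n + 2 : ℕ) : ℝ) := by
  have hlin := lin_pos η₀ n (by linarith : -1/2 < t)
  have hneg : -4 / ((((η₀ * n + 2 : ℕ) : ℝ) + 2 * t)) ^ 2 ≤ 0 :=
    div_nonpos_of_nonpos_of_nonneg (by norm_num) (by positivity)
  unfold d2logR
  linarith [polesum_sq_le η₀ η n ht]

/-- `(log R)′² + (log R)″ ≤ 25 h₀²` on `t ≥ 0`. -/
theorem bracket_le (η₀ : ℕ) (η : Fin 4 → ℕ) (n : ℕ) {t : ℝ} (ht : 0 ≤ t) :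
    dlogR η₀ η n t ^ 2 + d2logR η₀ η n t ≤ 25 * ((η₀ * n + 2 : ℕ) : ℝ) ^ 2 := by
  have ha := abs_dlogR_le η₀ η n ht
  have hb := d2logR_le η₀ η n ht
  have h2 : (2 : ℝ) ≤ ((η₀ * n + 2 : ℕ) : ℝ) := by exact_mod_cast Nat.le_add_left 2 _
  have hsq : dlogR η₀ η n t ^ 2 ≤ (1 + 4 * ((η₀ * n + 2 : ℕ) : ℝ)) ^ 2 := by
    rw [← sq_abs]
    exact pow_le_pow_left₀ (abs_nonneg _) ha 2
  nlinarith

/-- `0 ≤ R″(t)` for `t ≥ 0` (in fact `> 0`). -/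
theorem iteratedDeriv_two_faceR_pos (η₀ : ℕ) (η : Fin 4 → ℕ) (hη : ∀ j, 2 * η j < η₀) (n : ℕ)
    {t : ℝ} (ht : 0 ≤ t) : 0 < iteratedDeriv 2 (faceR η₀ η n) t := by
  rw [iteratedDeriv_two_faceR η₀ η n (by linarith : -1/2 < t)]
  exact mul_pos (faceR_pos η₀ η n (by linarith)) (by nlinarith [d2logR_pos η₀ η hη n ht])

/-- `R″(t) ≤ 25 h₀² · R(t)` for `t ≥ 0`. -/
theorem iteratedDeriv_two_faceR_le (η₀ : ℕ) (η : Fin 4 → ℕ) (n : ℕ) {t : ℝ} (ht : 0 ≤ t) :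
    iteratedDeriv 2 (faceR η₀ η n) t ≤ 25 * ((η₀ * n + 2 : ℕ) : ℝ) ^ 2 * faceR η₀ η n t := by
  rw [iteratedDeriv_two_faceR η₀ η n (by linarith : -1/2 < t)]
  have hR := faceR_pos η₀ η n (by linarith : -1/2 < t)
  nlinarith [bracket_le η₀ η n ht]
/-! ## 8. Polynomial decay of `R` on `t ≥ 0`
Each colour block satisfies `P_j(t) ≤ (h₀/(t+h₀))·P_j(0)` (drop `t` from all but the first pole, then
`h_j/(t+h_j) ≤ h₀/(t+h₀)`), so `R(t) ≤ ((h₀+2t)/h₀)(h₀/(t+h₀))⁴ R(0) ≤ 2h₀³/(t+h₀)³ · R(0)`. -/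

/-- one colour block: `P_j(t) ≤ (h₀/(t+h₀)) · P_j(0)` for `t ≥ 0`. -/
theorem block_decay (η₀ : ℕ) (η : Fin 4 → ℕ) (hη : ∀ j, 2 * η j < η₀) (n : ℕ) (j : Fin 4)
    {t : ℝ} (ht : 0 ≤ t) :
    ((((η₀ * n + 2) - 2 * (η j * n + 1)).factorial : ℕ) : ℝ)
        / ∏ i ∈ Finset.range ((η₀ * n + 2) - 2 * (η j * n + 1) + 1),
            (t + ((η j * n + 1 : ℕ) : ℝ) + (i : ℝ))
      ≤ (((η₀ * n + 2 : ℕ) : ℝ) / (t + ((η₀ * n + 2 : ℕ) : ℝ))) *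
        (((((η₀ * n + 2) - 2 * (η j * n + 1)).factorial : ℕ) : ℝ)
          / ∏ i ∈ Finset.range ((η₀ * n + 2) - 2 * (η j * n + 1) + 1),
            ((0 : ℝ) + ((η j * n + 1 : ℕ) : ℝ) + (i : ℝ))) := by
  set hj : ℝ := ((η j * n + 1 : ℕ) : ℝ) with hhj
  set h0 : ℝ := ((η₀ * n + 2 : ℕ) : ℝ) with hh0
  set m : ℕ := (η₀ * n + 2) - 2 * (η j * n + 1) with hm
  set A : ℝ := ((m.factorial : ℕ) : ℝ) with hA
  have hjpos : 0 < hj := by rw [hhj]; positivity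
  have hj1 : 1 ≤ hj := by rw [hhj]; exact_mod_cast Nat.le_add_left 1 _
  have hjle : hj ≤ h0 := (hj_lt_h0 η₀ η hη n j).le
  have h0pos : 0 < h0 := by rw [hh0]; positivity
  have hApos : 0 < A := by rw [hA]; exact_mod_cast Nat.factorial_pos _
  rw [Finset.prod_range_succ', Finset.prod_range_succ']
  simp only [Nat.cast_zero, add_zero, Nat.cast_succ, zero_add]
  set Q : ℝ → ℝ := fun s => ∏ i ∈ Finset.range m, (s + hj + ((i : ℝ) + 1)) with hQ
  have hQ0pos : 0 < Q 0 := Finset.prod_pos fun i _ => by positivity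
  have hQle : Q 0 ≤ Q t :=
    Finset.prod_le_prod (fun i _ => by positivity) (fun i _ => by linarith)
  have htj : 0 < t + hj := by linarith
  have ht0 : 0 < t + h0 := by linarith
  have step1 : A / (Q t * (t + hj)) ≤ A / (Q 0 * (t + hj)) :=
    div_le_div_of_nonneg_left hApos.le (by positivity) (by nlinarith)
  have step2 : A / (Q 0 * (t + hj)) = (hj / (t + hj)) * (A / (Q 0 * hj)) := by
    field_simp
  have step3 : hj / (t + hj) ≤ h0 / (t + h0) := by
    rw [div_le_div_iff₀ htj ht0]; nlinarith
  have hP0 : 0 ≤ A / (Q 0 * hj) := by positivity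
  have hQ0 : Q 0 = ∏ i ∈ Finset.range m, (hj + ((i : ℝ) + 1)) := by
    simp only [hQ, zero_add]
  calc A / (Q t * (t + hj)) ≤ A / (Q 0 * (t + hj)) := step1
    _ = (hj / (t + hj)) * (A / (Q 0 * hj)) := step2
    _ ≤ (h0 / (t + h0)) * (A / (Q 0 * hj)) := mul_le_mul_of_nonneg_right step3 hP0
    _ = _ := by rw [hQ0]

/-- DECAY: `R(t) ≤ 2h₀³/(t+h₀)³ · R(0)` for `t ≥ 0`. -/
theorem faceR_decay (η₀ : ℕ) (η : Fin 4 → ℕ) (hη : ∀ j, 2 * η j < η₀) (n : ℕ) {t : ℝ} (ht : 0 ≤ t) :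
    faceR η₀ η n t ≤ 2 * ((η₀ * n + 2 : ℕ) : ℝ) ^ 3 / (t + ((η₀ * n + 2 : ℕ) : ℝ)) ^ 3
      * faceR η₀ η n 0 := by
  set h0 : ℝ := ((η₀ * n + 2 : ℕ) : ℝ) with hh0
  have h0pos : 0 < h0 := by rw [hh0]; positivity
  have ht0 : 0 < t + h0 := by linarith
  have hpole := pole_pos η n (by linarith : -1/2 < t)
  have hpole0 := pole_pos η n (by norm_num : -1/2 < (0 : ℝ))
  -- the product of the blocks
  have hprod : (∏ j : Fin 4, ((((η₀ * n + 2) - 2 * (η j * n + 1)).factorial : ℕ) : ℝ)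
        / ∏ i ∈ Finset.range ((η₀ * n + 2) - 2 * (η j * n + 1) + 1),
            (t + ((η j * n + 1 : ℕ) : ℝ) + (i : ℝ)))
      ≤ (h0 / (t + h0)) ^ 4 * ∏ j : Fin 4, ((((η₀ * n + 2) - 2 * (η j * n + 1)).factorial : ℕ) : ℝ)
        / ∏ i ∈ Finset.range ((η₀ * n + 2) - 2 * (η j * n + 1) + 1),
            ((0 : ℝ) + ((η j * n + 1 : ℕ) : ℝ) + (i : ℝ)) := by
    have h := Finset.prod_le_prod (s := (Finset.univ : Finset (Fin 4)))
      (fun j _ => div_nonneg (Nat.cast_nonneg _)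
        (Finset.prod_nonneg fun i _ => (hpole j i).le))
      (fun j _ => block_decay η₀ η hη n j ht)
    rw [Finset.prod_mul_distrib, Finset.prod_const, Finset.card_univ, Fintype.card_fin] at h
    exact h
  have hP0 : 0 ≤ ∏ j : Fin 4, ((((η₀ * n + 2) - 2 * (η j * n + 1)).factorial : ℕ) : ℝ)
        / ∏ i ∈ Finset.range ((η₀ * n + 2) - 2 * (η j * n + 1) + 1),
            ((0 : ℝ) + ((η j * n + 1 : ℕ) : ℝ) + (i : ℝ)) :=
    Finset.prod_nonneg fun j _ => div_nonneg (Nat.cast_nonneg _)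
      (Finset.prod_nonneg fun i _ => (hpole0 j i).le)
  have hlin : 0 ≤ h0 + 2 * t := by linarith
  have hcoef : (h0 + 2 * t) * (h0 / (t + h0)) ^ 4 ≤ 2 * h0 ^ 3 / (t + h0) ^ 3 * (h0 + 2 * 0) := by
    rw [mul_zero, add_zero, div_pow, ← mul_div_assoc, div_mul_eq_mul_div,
      div_le_div_iff₀ (by positivity) (by positivity)]
    have h4 : (t + h0) ^ 4 = (t + h0) ^ 3 * (t + h0) := by ring
    rw [h4]
    have hA : 0 < (t + h0) ^ 3 := by positivity
    have hB : 0 < h0 ^ 3 := by positivity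
    nlinarith [mul_pos hA hB]
  unfold faceR
  simp only [mul_zero, add_zero] at hcoef ⊢
  calc (h0 + 2 * t) * ∏ j : Fin 4, ((((η₀ * n + 2) - 2 * (η j * n + 1)).factorial : ℕ) : ℝ)
        / ∏ i ∈ Finset.range ((η₀ * n + 2) - 2 * (η j * n + 1) + 1),
            (t + ((η j * n + 1 : ℕ) : ℝ) + (i : ℝ))
      ≤ (h0 + 2 * t) * ((h0 / (t + h0)) ^ 4 * ∏ j : Fin 4,
          ((((η₀ * n + 2) - 2 * (η j * n + 1)).factorial : ℕ) : ℝ)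
          / ∏ i ∈ Finset.range ((η₀ * n + 2) - 2 * (η j * n + 1) + 1),
            ((0 : ℝ) + ((η j * n + 1 : ℕ) : ℝ) + (i : ℝ))) :=
        mul_le_mul_of_nonneg_left hprod hlin
    _ = ((h0 + 2 * t) * (h0 / (t + h0)) ^ 4) * ∏ j : Fin 4,
          ((((η₀ * n + 2) - 2 * (η j * n + 1)).factorial : ℕ) : ℝ)
          / ∏ i ∈ Finset.range ((η₀ * n + 2) - 2 * (η j * n + 1) + 1),
            ((0 : ℝ) + ((η j * n + 1 : ℕ) : ℝ) + (i : ℝ)) := by ring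
    _ ≤ (2 * h0 ^ 3 / (t + h0) ^ 3 * h0) * ∏ j : Fin 4,
          ((((η₀ * n + 2) - 2 * (η j * n + 1)).factorial : ℕ) : ℝ)
          / ∏ i ∈ Finset.range ((η₀ * n + 2) - 2 * (η j * n + 1) + 1),
            ((0 : ℝ) + ((η j * n + 1 : ℕ) : ℝ) + (i : ℝ)) :=
        mul_le_mul_of_nonneg_right hcoef hP0
    _ = _ := by ring

end Summit.KontsevichZagierPeriods.Zeta5Search.WellPoisedFaceRate
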